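import Summits.KontsevichZagierPeriods.KontsevichZagierPeriods.Theses.SpectrahedralScissors
import Summits.KontsevichZagierPeriods.KontsevichZagierPeriods.Theses.AbelContraction
import Summits.KontsevichZagierPeriods.KontsevichZagierPeriods.Theorems.AbelContractionRealArcKernelSplit

/-!
# Crux `SeparabilityKernel` (stmt-KontsevichZagierPeriods-9263) — line `dimension-filtration`
# (strategist cstrat-…-9263-s2, 2026-08-17; PUBLISHED as a crux workfile, NOT skeleton-registered:
# `ledger skeleton check` has no `--alt` and would supersede the registered birth skeleton)

Route `SpectrahedralScissors`, rank-0 TARGET crux `SeparabilityKernel`: the kernel conjecture of the KZ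
calculus ENLARGED by the two separability relators, `ker KZ.eval ⊆ closure (four move sets ∪ S_ℝ ∪ S_ℂ)`
(GPC-strength, stated openly by the route).

This line cuts the crux along the **input-dimension filtration**, exactly where the sibling enlarged-kernel
targets `AbelContraction.RealArcKernel` (stmt-12472, BC2 redirect, `Theorems/AbelContractionRealArcKernelSplit.lean`)
and `ComplexOrientations.OrientationKernel` (stmt-11367) are cut: BOTH stubs are EXISTING SHARED ITEMS verbatim.

* `stub_kzDimTwo` = item stmt-KontsevichZagierPeriods-4280 `KZDimTwo` VERBATIM (shared by AbelContraction /
  HodgeLevel / BianchiHumbert / DessinsDimensionOne / ComplexOrientations; six registered stubs of its own):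
  Conjecture 1 on the dimension-two stratum. Strictly weaker than the summit (fixed input dimension ≤ 2); it
  contains the 1-period layer `PlanarAreas` (`planarAreas_of_kzDimTwo`), which is Huber–Wüstholz's theorem
  transferred into the rules.
* `stub_reductionToDimensionTwo` = item stmt-KontsevichZagierPeriods-18030 `ReductionToDimensionTwo` VERBATIM
  (shared by AbelContraction / ComplexOrientations): every `R ≥ KZ.relations` containing the equal-valued
  KZ-rational pairs of dimensions `≤ 2` contains `ker KZ.eval`. GPC-strength MODULO the open stratum — the common
  residue of every enlarged-kernel target of the sub-problem, one item, staffed once.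

Composition `SeparabilityKernel_of_stubs : S1 → S2 → SeparabilityKernel` is pure logic (take `R :=` the enlarged
closure, `≥ KZ.relations` by monotonicity; S1 puts the stratum pairs in `KZ.relations ≤ R`; S2 gives
`ker eval ≤ R`); the two separability relators are not consumed (they are free in `R`). The same term, typed over
the AbelContraction decls, is the strategist's kernel-checked split glue `separabilityKernel_of_subs`
(folder `SpectrahedralScissorsSeparabilityKernelSplit.lean`, rc 0, axioms propext / Classical.choice / Quot.sound).

Sandwich (logical position, all LANDED in `Theorems/AbelContractionRealArcKernelSplit.lean`): summit ⟹ S1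
(`kzDimTwo_of_kontsevichZagierPeriods`), summit ⟹ S2 (`reductionToDimensionTwo_of_kontsevichZagierPeriods`),
S1 ∧ S2 ⟹ summit (`kontsevichZagierPeriods_of_subs`) — recorded below as `stubs_decide_summit`; so a refutation
of either stub refutes the SUMMIT (consistent with the route's kill criteria), and the line is honest about being
"the summit, consolidated", which every line for this GPC-strength crux must be.

Why it dodges the birth line's position: birth's stubs `stub_spectrahedralHilbertThree` (an open-ended FAMILY of
Hilbert-III problems for rational spectrahedra) and `stub_volumeFormModSpectrahedra` (a PRIVATE GPC-residue) are
wanted by no other route and attackable by no prover as typed; here the weaker stub is a live five-route crux and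
the residue is the shared one. No stuck goal exists (no lead was ever seated on this target).

Disproof used: none on record (`ledger crux ls`: no Disproof.lean; negatives index: 1 entry, KinematicPlaneConvex,
unrelated). Degenerate data: `c = 0` trivial; `n = m = 0` pairs in S1 are constants (LowdimDimZero, proved).
-/

noncomputable section

set_option linter.dupNamespace false

namespace Summit.KontsevichZagierPeriods.KontsevichZagierPeriods.Cruxes.SeparabilityKernel.DimensionFiltration

open Literature.NumberTheory.Transcendental

/-! ### Registered-shape stubs (the only `sorry`s of this file; statements = items 4280 / 18030 verbatim) -/

/-- **STUB S1 = item stmt-KontsevichZagierPeriods-4280 `KZDimTwo` (verbatim).** Conjecture 1 on the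
dimension-two stratum. Why it might fail: completeness on the stratum needs a transcendence theory of 2-periods
nobody has (dilog/Clausen values at algebraic points; ζ(2)·ℚ̄, L(2,χ), Legendre-type relations as areas).
[cite: KontsevichZagier2001, §1.2 Conjecture 1] [cite: HuberWustholz2022, Thm 13.3] -/
theorem stub_kzDimTwo :
    ∀ ⦃n m : ℕ⦄, n ≤ 2 → m ≤ 2 → ∀ (r : Literature.NumberTheory.Transcendental.KZ.IntegralRep n) (r' : Literature.NumberTheory.Transcendental.KZ.IntegralRep m), r.IsRational → r'.IsRational → r.value = r'.value → Literature.NumberTheory.Transcendental.KZ.Equivalent r r' := by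
  sorry

/-- **STUB S2 = item stmt-KontsevichZagierPeriods-18030 `ReductionToDimensionTwo` (verbatim).** GPC-strength
modulo the open stratum, stated openly. Why it might fail: iff a value-0 combination of inputs beyond the
stratum (ζ(3)/MZV, Γ-products, elliptic quasi-period products) is underivable even with every stratum-2
coincidence adjoined. [cite: KontsevichZagier2001, §1.2 Conjecture 1] [cite: HuberMullerStachPeriods2017, Conj. 13.2.1] -/
theorem stub_reductionToDimensionTwo :
    ∀ R : AddSubgroup Literature.NumberTheory.Transcendental.KZ.FormalRep, Literature.NumberTheory.Transcendental.KZ.relations ≤ R → (∀ ⦃n m : ℕ⦄, n ≤ 2 → m ≤ 2 → ∀ (r : Literature.NumberTheory.Transcendental.KZ.IntegralRep n) (r' : Literature.NumberTheory.Transcendental.KZ.IntegralRep m), r.IsRational → r'.IsRational → r.value = r'.value → Literature.NumberTheory.Transcendental.KZ.of r - Literature.NumberTheory.Transcendental.KZ.of r' ∈ R) → ∀ x : Literature.NumberTheory.Transcendental.KZ.FormalRep, Literature.NumberTheory.Transcendental.KZ.eval x = 0 → x ∈ R := by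
  sorry

/-! ### Composition and logical position (no `sorry` below this line) -/

/-- The stub statements ARE the shared items (definitional). -/
theorem stub_kzDimTwo_iff_item :
    (∀ ⦃n m : ℕ⦄, n ≤ 2 → m ≤ 2 → ∀ (r : KZ.IntegralRep n) (r' : KZ.IntegralRep m), r.IsRational → r'.IsRational →
      r.value = r'.value → KZ.Equivalent r r') ↔
    Summit.KontsevichZagierPeriods.KontsevichZagierPeriods.Theses.AbelContraction.KZDimTwo := Iff.rfl

theorem stub_reductionToDimensionTwo_iff_item :
    (∀ R : AddSubgroup KZ.FormalRep, KZ.relations ≤ R → (∀ ⦃n m : ℕ⦄, n ≤ 2 → m ≤ 2 → ∀ (r : KZ.IntegralRep n)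
      (r' : KZ.IntegralRep m), r.IsRational → r'.IsRational → r.value = r'.value → KZ.of r - KZ.of r' ∈ R) →
      ∀ x : KZ.FormalRep, KZ.eval x = 0 → x ∈ R) ↔
    Summit.KontsevichZagierPeriods.KontsevichZagierPeriods.Theses.AbelContraction.ReductionToDimensionTwo := Iff.rfl

/-- `KZ.relations` is inside the enlarged closure of the crux, for ANY relator set (monotonicity). -/
theorem relations_le_closure_union (S : Set KZ.FormalRep) :
    KZ.relations ≤ AddSubgroup.closure (KZ.domainAddRel ∪ KZ.integrandAddRel ∪ KZ.changeOfVariablesRel ∪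
      KZ.newtonLeibnizRel ∪ S) :=
  AddSubgroup.closure_mono Set.subset_union_left

/-- **Decomposition theorem (real proof; hypotheses = the two stub statements, i.e. the two shared items).** -/
theorem SeparabilityKernel_of_stubs
    (h₁ : Summit.KontsevichZagierPeriods.KontsevichZagierPeriods.Theses.AbelContraction.KZDimTwo)
    (h₂ : Summit.KontsevichZagierPeriods.KontsevichZagierPeriods.Theses.AbelContraction.ReductionToDimensionTwo) :
    Summit.KontsevichZagierPeriods.KontsevichZagierPeriods.Theses.SpectrahedralScissors.SeparabilityKernel :=
  fun c hc =>
    h₂ _ (relations_le_closure_union _)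
      (fun _ _ hn hm r r' hr hr' hv => relations_le_closure_union _ (h₁ hn hm r r' hr hr' hv)) c hc

/-- **The crux BY NAME from the two stubs.** Its only `sorryAx` dependencies are `stub_kzDimTwo` and
`stub_reductionToDimensionTwo`. -/
theorem SeparabilityKernel_of :
    Summit.KontsevichZagierPeriods.KontsevichZagierPeriods.Theses.SpectrahedralScissors.SeparabilityKernel :=
  SeparabilityKernel_of_stubs stub_kzDimTwo stub_reductionToDimensionTwo

/-- Logical position, landed elsewhere and only re-exported: the two stub statements jointly DECIDE the summit
(`kontsevichZagierPeriods_of_subs`) and each is NECESSARY for it. -/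
theorem stubs_decide_summit :
    (Summit.KontsevichZagierPeriods.KontsevichZagierPeriods.Theses.AbelContraction.KZDimTwo ∧
      Summit.KontsevichZagierPeriods.KontsevichZagierPeriods.Theses.AbelContraction.ReductionToDimensionTwo) ↔
    _root_.KontsevichZagierPeriods :=
  ⟨fun h => Summit.KontsevichZagierPeriods.AbelContraction.RealArcKernelSplit.kontsevichZagierPeriods_of_subs h.1 h.2,
   fun h => ⟨Summit.KontsevichZagierPeriods.AbelContraction.RealArcKernelSplit.kzDimTwo_of_kontsevichZagierPeriods h,
     Summit.KontsevichZagierPeriods.AbelContraction.RealArcKernelSplit.reductionToDimensionTwo_of_kontsevichZagierPeriods h⟩⟩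

end Summit.KontsevichZagierPeriods.KontsevichZagierPeriods.Cruxes.SeparabilityKernel.DimensionFiltration
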